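import Literature.AlgebraicGeometry.Motives.MixedHodgeStructureUniserial
import Literature.AlgebraicGeometry.Motives.MixedHodgeStructureBidual
import Literature.AlgebraicGeometry.Motives.MixedHodgeStructureDevissage
import Literature.AlgebraicGeometry.Motives.MixedHodgeStructureMultiplicityFormulas
import HarnessLib

/-!
# Jordan–Hölder multiplicities under duality: `[H^∨ : S^∨] = [H : S]`

Sequel to `MixedHodgeStructureCompositionMultiplicity` (`[H : S] = H.multiplicity S`, additive on
`0 → R → H → H/R → 0`, invariant under isomorphisms), `MixedHodgeStructureLengthFormulas` §5 (`λ(H^∨) = λ(H)`),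
`MixedHodgeStructureDualSubobjects` (`(H/S)^∨ ≅ S^⊥`, `H^∨/S^⊥ ≅ S^∨`) and `MixedHodgeStructureDevissage`. Fujiki, *Duality of mixed Hodge
structures of algebraic varieties*, (1.6.2): a) `H ≅ H^∨∨`; b) for a mixed Hodge substructure `E ⊆ H` the orthogonal
`E^⊥ ⊆ H^∨` is a mixed Hodge substructure and the induced pairings give dualities of mixed Hodge structures
`(H/E)^∨ ≅ E^⊥`, `E^∨ ≅ H^∨/E^⊥` (the tree's `quotientDualHom`, `dualQuotientHom`); Cattani–El Zein–Griffiths–Lê,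
*Hodge Theory*, §3.2.2.7 (dual MHS), Thm. 3.2.18; Beachy, *Introductory Lectures on Rings and Modules*, §2.5,
Def. 2.5.1 / Thm. 2.5.2 (Jordan–Hölder).

* §1 `H^∨ ≅ H'^∨ ⟺ H ≅ H'` (transpose and biduality); the restriction of an isomorphism to a pulled-back sub-MHS is
  an isomorphism.
* §2 **the dual of a composition factor is a composition factor of the dual**: for sub-MHS `A ⊆ B` of `H`,
  `A^⊥ / B^⊥ ≅ (B/A)^∨` (`subquotientIsoTo_annihilator_dual`; in general `(A ∩ B)^⊥ / B^⊥ ≅ (B/(A ∩ B))^∨`), so the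
  factor `A^⊥/B^⊥` of `H^∨` is `≅ S^∨` iff `B/A ≅ S` (`subquotientIsoTo_annihilator_dual_iff`).
* §4 the factors of the dual composition series `s^∨` of `…LengthFormulas` are the duals of the factors of `s` in
  reverse order (`CompositionSeries.subquotientIsoTo_dual_iff`), so `s^∨` counts `S^∨` as often as `s` counts `S`
  (`CompositionSeries.count_dual`).
* §3 **`[H^∨ : S^∨] = [H : S]`** (`multiplicity_dual`) by dévissage (`induction_on_extension`: additivity of `[· : S]`
  on `0 → R → H → H/R → 0` and on the dual sequence `0 → (H/R)^∨ ≅ R^⊥ → H^∨ → H^∨/R^⊥ ≅ R^∨ → 0`); also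
  `[H^∨ : S] = [H : S^∨]`, `[H^∨∨ : S] = [H : S]`, and self-dual `S`.

All statements proved; no definitions, no named facts, no instances.

## References

* [Fujiki1980] A. Fujiki, Duality of mixed Hodge structures of algebraic varieties, Publ. RIMS 16 (1980), (1.6.2) a), b).
* [CattaniElZeinGriffithsLe2014] E. Cattani et al. (eds.), Hodge Theory (2014), §3.2.2.7, Thm. 3.2.18, Lemma 3.2.20.
* [Beachy1999RingsModules] J. A. Beachy, Introductory Lectures on Rings and Modules (1999), §2.5, Def. 2.5.1, Thm. 2.5.2.
-/

noncomputable section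

namespace Literature.AlgebraicGeometry.Motives

namespace MixedHodgeStructure

universe u v w

variable {V : Type u} [AddCommGroup V] [Module ℚ V]
variable {V' : Type v} [AddCommGroup V'] [Module ℚ V']
variable {U : Type w} [AddCommGroup U] [Module ℚ U]
variable {H : MixedHodgeStructure V} {H' : MixedHodgeStructure V'} {S : MixedHodgeStructure U}

open SubMixedHodgeStructure

section IsoHelpers

universe w₁ w₂ w₃
variable {W₁ : Type w₁} [AddCommGroup W₁] [Module ℚ W₁] {G₁ : MixedHodgeStructure W₁}
variable {W₂ : Type w₂} [AddCommGroup W₂] [Module ℚ W₂] {G₂ : MixedHodgeStructure W₂}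
variable {W₃ : Type w₃} [AddCommGroup W₃] [Module ℚ W₃] {G₃ : MixedHodgeStructure W₃}

/-- "Isomorphic" is symmetric. [cite: CattaniElZeinGriffithsLe2014, Thm. 3.2.18] -/
private theorem iso_symm (h : ∃ e : Hom G₁ G₂, Function.Bijective e.toLinearMap) :
    ∃ e : Hom G₂ G₁, Function.Bijective e.toLinearMap := by
  obtain ⟨e, he⟩ := h
  refine ⟨e.inverse he, ?_⟩
  rw [Hom.inverse_toLinearMap]
  exact (LinearEquiv.ofBijective e.toLinearMap he).symm.bijective

/-- "Isomorphic" is transitive. [cite: CattaniElZeinGriffithsLe2014, Thm. 3.2.18] -/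
private theorem iso_trans (h₁ : ∃ e : Hom G₁ G₂, Function.Bijective e.toLinearMap)
    (h₂ : ∃ e : Hom G₂ G₃, Function.Bijective e.toLinearMap) :
    ∃ e : Hom G₁ G₃, Function.Bijective e.toLinearMap := by
  obtain ⟨e₁, he₁⟩ := h₁
  obtain ⟨e₂, he₂⟩ := h₂
  refine ⟨e₂.comp e₁, ?_⟩
  rw [Hom.comp_toLinearMap, LinearMap.coe_comp]
  exact he₂.comp he₁

end IsoHelpers

/-! ### §1 Isomorphisms under duality; restriction of isomorphisms -/

/-- **`H^∨ ≅ H'^∨` iff `H ≅ H'`** (transpose an isomorphism; conversely transpose again and use `H ≅ H^∨∨`).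
[cite: Fujiki1980, (1.6.2) a)] [cite: CattaniElZeinGriffithsLe2014, §3.2.2.7 and Thm. 3.2.18] -/
theorem exists_bijective_hom_dual_iff [FiniteDimensional ℚ V] [FiniteDimensional ℚ V'] :
    (∃ e : Hom H.dual H'.dual, Function.Bijective e.toLinearMap) ↔ ∃ e : Hom H H', Function.Bijective e.toLinearMap := by
  constructor
  · rintro ⟨e, he⟩
    -- `H' ≅ H'^∨∨ ≅ H^∨∨ ≅ H`
    have h : ∃ g : Hom H' H, Function.Bijective g.toLinearMap :=
      iso_trans (iso_trans ⟨Hom.bidual H', Hom.bidual_bijective H'⟩ ⟨e.transpose, (Hom.transpose_bijective_iff e).2 he⟩)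
        (iso_symm ⟨Hom.bidual H, Hom.bidual_bijective H⟩)
    exact iso_symm h
  · rintro ⟨e, he⟩
    exact iso_symm ⟨e.transpose, (Hom.transpose_bijective_iff e).2 he⟩

/-- **The restriction `f|: f⁻¹(T) → T` of an isomorphism `f : H ⥲ H'` to a pulled-back sub-MHS is an isomorphism.**
[cite: CattaniElZeinGriffithsLe2014, Lemma 3.2.20 and Thm. 3.2.18] -/
theorem SubMixedHodgeStructure.bijective_restrictHom_comap (f : Hom H H') (hf : Function.Bijective f.toLinearMap)
    (T : SubMixedHodgeStructure H') :
    Function.Bijective ((T.comap f).restrictHom T f (fun _ hx => hx)).toLinearMap := by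
  refine ⟨fun x y hxy => ?_, fun y => ?_⟩
  · have h' := congrArg Subtype.val hxy
    simp only [coe_restrictHom_apply] at h'
    exact Subtype.ext (hf.1 h')
  · obtain ⟨x, hx⟩ := hf.2 (y : V')
    refine ⟨⟨x, ?_⟩, Subtype.ext ?_⟩
    · show f.toLinearMap x ∈ T.toSubmodule
      rw [hx]
      exact y.2
    · rw [coe_restrictHom_apply, hx]

/-! ### §2 The dual of a composition factor: `(A ∩ B)^⊥ / B^⊥ ≅ (B / (A ∩ B))^∨` -/

/-- **The dual of a subquotient is a subquotient of the dual**: for sub-MHS `A`, `B` of `H`, the composition factor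
`(A ∩ B)^⊥ / B^⊥` of `H^∨` is isomorphic to the dual `(B/(A ∩ B))^∨` of the composition factor `B/(A ∩ B)` of `H` —
`(B/(A∩B))^∨ ≅ (A∩B)^⊥_{B^∨}` ((1.6.2) b) for `A ∩ B ⊆ B`) and `B^∨ ≅ H^∨/B^⊥` ((1.6.2) b) for `B ⊆ H`), under which
`(A∩B)^⊥_{B^∨}` corresponds to `(A ∩ B)^⊥/B^⊥`. [cite: Fujiki1980, (1.6.2) b)] [cite: CattaniElZeinGriffithsLe2014, §3.2.2.7 and Lemma 3.2.20] -/
theorem SubMixedHodgeStructure.subquotientIsoTo_annihilator_dual [FiniteDimensional ℚ V] (A B : SubMixedHodgeStructure H) :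
    SubquotientIsoTo B.annihilator (A.inf B).annihilator (A.comap B.subtype).quotient.dual := by
  -- notation: `G = B` as an MHS, `C = A ∩ B ⊆ G`, `π : H^∨/B^⊥ ⥲ G^∨`, `D = π⁻¹(C^⊥)`, `E = (H^∨ ↠ H^∨/B^⊥)⁻¹(D)`
  set C : SubMixedHodgeStructure B.toMixedHodgeStructure := A.comap B.subtype with hC
  set D : SubMixedHodgeStructure B.annihilator.quotient := C.annihilator.comap B.dualQuotientHom with hD
  -- `E = (A ∩ B)^⊥`
  have hE : D.comap B.annihilator.mkQ = (A.inf B).annihilator := by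
    refine SubMixedHodgeStructure.ext ?_
    ext φ
    rw [comap_toSubmodule, Submodule.mem_comap, hD, comap_toSubmodule, Submodule.mem_comap,
      show B.annihilator.mkQ.toLinearMap φ = Submodule.Quotient.mk φ from rfl, dualQuotientHom_apply_mk,
      annihilator_toSubmodule, Submodule.mem_dualAnnihilator, annihilator_toSubmodule, Submodule.mem_dualAnnihilator]
    constructor
    · intro h w hw
      rw [inf_toSubmodule, Submodule.mem_inf] at hw
      exact h ⟨w, hw.2⟩ hw.1
    · intro h x hx
      rw [LinearMap.comp_apply]
      exact h x (by rw [inf_toSubmodule, Submodule.mem_inf]; exact ⟨hx, x.2⟩)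
  -- `B^⊥ = Ker(H^∨ ↠ H^∨/B^⊥)`
  have hker : B.annihilator.mkQ.ker = B.annihilator :=
    SubMixedHodgeStructure.ext (by rw [Hom.ker_toSubmodule]; exact Submodule.ker_mkQ _)
  -- `E/B^⊥ ≅ D ≅ C^⊥ ≅ (B/C)^∨`
  have h₁ : SubquotientIsoTo B.annihilator (D.comap B.annihilator.mkQ) D.toMixedHodgeStructure := by
    have h := subquotientIsoTo_ker_comap B.annihilator.mkQ (mkQ_surjective _) D
    rwa [hker] at h
  have h₂ : ∃ e : Hom D.toMixedHodgeStructure C.annihilator.toMixedHodgeStructure, Function.Bijective e.toLinearMap :=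
    ⟨_, bijective_restrictHom_comap B.dualQuotientHom B.dualQuotientHom_bijective C.annihilator⟩
  have h₃ : ∃ e : Hom C.annihilator.toMixedHodgeStructure C.quotient.dual, Function.Bijective e.toLinearMap :=
    iso_symm ⟨C.quotientDualHom, C.quotientDualHom_bijective⟩
  rw [← hE]
  exact iso_trans (iso_trans h₁ h₂) h₃

/-- **For `A ⊆ B`: the composition factor `A^⊥ / B^⊥` of `H^∨` is `(B/A)^∨`.** [cite: Fujiki1980, (1.6.2) b)]
[cite: CattaniElZeinGriffithsLe2014, §3.2.2.7] -/
theorem SubMixedHodgeStructure.subquotientIsoTo_annihilator_dual_of_le [FiniteDimensional ℚ V] {A B : SubMixedHodgeStructure H}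
    (h : A.toSubmodule ≤ B.toSubmodule) :
    SubquotientIsoTo B.annihilator A.annihilator (A.comap B.subtype).quotient.dual := by
  have e : A.inf B = A := SubMixedHodgeStructure.ext (by rw [inf_toSubmodule]; exact inf_eq_left.2 h)
  have h' := subquotientIsoTo_annihilator_dual A B
  rwa [e] at h'

/-- **The factor `(A ∩ B)^⊥ / B^⊥` of `H^∨` is `≅ T` iff `(B/(A ∩ B))^∨ ≅ T`.** [cite: Fujiki1980, (1.6.2) b)]
[cite: Beachy1999RingsModules, §2.5, Def. 2.5.1] -/
theorem SubMixedHodgeStructure.subquotientIsoTo_annihilator_iff [FiniteDimensional ℚ V] (A B : SubMixedHodgeStructure H)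
    {T : MixedHodgeStructure U} :
    SubquotientIsoTo B.annihilator (A.inf B).annihilator T ↔
      ∃ e : Hom (A.comap B.subtype).quotient.dual T, Function.Bijective e.toLinearMap :=
  ⟨fun h => iso_trans (iso_symm (subquotientIsoTo_annihilator_dual A B)) h,
    fun h => iso_trans (subquotientIsoTo_annihilator_dual A B) h⟩

/-- **The factor `(A ∩ B)^⊥ / B^⊥` of `H^∨` is isomorphic to `S^∨` iff the factor `B/(A ∩ B)` of `H` is isomorphic
to `S`.** [cite: Fujiki1980, (1.6.2) a), b)] [cite: Beachy1999RingsModules, §2.5, Def. 2.5.1] -/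
theorem SubMixedHodgeStructure.subquotientIsoTo_annihilator_dual_iff [FiniteDimensional ℚ V] [FiniteDimensional ℚ U]
    (A B : SubMixedHodgeStructure H) :
    SubquotientIsoTo B.annihilator (A.inf B).annihilator S.dual ↔ SubquotientIsoTo A B S := by
  rw [subquotientIsoTo_annihilator_iff]
  exact exists_bijective_hom_dual_iff

/-- The same for `A ⊆ B`: `A^⊥/B^⊥ ≅ S^∨` iff `B/A ≅ S`. [cite: Fujiki1980, (1.6.2) a), b)] [cite: Beachy1999RingsModules, §2.5, Def. 2.5.1] -/
theorem SubMixedHodgeStructure.subquotientIsoTo_annihilator_dual_iff_of_le [FiniteDimensional ℚ V] [FiniteDimensional ℚ U]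
    {A B : SubMixedHodgeStructure H} (h : A.toSubmodule ≤ B.toSubmodule) :
    SubquotientIsoTo B.annihilator A.annihilator S.dual ↔ SubquotientIsoTo A B S := by
  have e : A.inf B = A := SubMixedHodgeStructure.ext (by rw [inf_toSubmodule]; exact inf_eq_left.2 h)
  rw [← subquotientIsoTo_annihilator_dual_iff A B, e]

/-- The factor `(A ∩ B)^⊥/B^⊥` of `H^∨` is simple iff the factor `B/(A ∩ B)` of `H` is. [cite: Fujiki1980, (1.6.2) b)]
[cite: CattaniElZeinGriffithsLe2014, p. 270] -/
theorem SubMixedHodgeStructure.isSimple_annihilator_subquotient_iff [FiniteDimensional ℚ V] (A B : SubMixedHodgeStructure H) :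
    ((B.annihilator).comap (A.inf B).annihilator.subtype).quotient.IsSimple ↔ (A.comap B.subtype).quotient.IsSimple := by
  rw [(subquotientIsoTo_annihilator_dual A B).isSimple_iff, isSimple_dual_iff]

/-! ### §3 `[H^∨ : S^∨] = [H : S]` by dévissage -/

/-- **Jordan–Hölder multiplicities are invariant under duality: `[H^∨ : S^∨] = [H : S]`.** By dévissage
(`induction_on_extension`): both sides vanish for `H = 0`; for simple `H` both are `1` or `0` according as `H ≅ S`
(`H^∨ ≅ S^∨ ⟺ H ≅ S`); and for a sub-MHS `R ⊆ H` additivity `[H : S] = [R : S] + [H/R : S]` is matched on the dual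
side by `[H^∨ : S^∨] = [R^⊥ : S^∨] + [H^∨/R^⊥ : S^∨]` with `R^⊥ ≅ (H/R)^∨` and `H^∨/R^⊥ ≅ R^∨` ((1.6.2) b)).
[cite: Beachy1999RingsModules, §2.5, Def. 2.5.1 and Thm. 2.5.2] [cite: Fujiki1980, (1.6.2) a), b)] [cite: CattaniElZeinGriffithsLe2014, §3.2.2.7] -/
theorem multiplicity_dual [FiniteDimensional ℚ V] [FiniteDimensional ℚ U] (H : MixedHodgeStructure V) (S : MixedHodgeStructure U) :
    H.dual.multiplicity S.dual = H.multiplicity S := by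
  refine induction_on_extension
    (P := fun {W} _ _ _ (G : MixedHodgeStructure W) => G.dual.multiplicity S.dual = G.multiplicity S)
    (fun G => ?_) (fun G hG => ?_) (fun G R hR hQ => ?_) H
  · -- `G = 0`
    have h := multiplicity_le_length G.dual S.dual
    rw [length_dual, length_eq_zero_iff.2 inferInstance, Nat.le_zero] at h
    rw [h, multiplicity_eq_zero_of_subsingleton G S]
  · -- `G` simple: `G^∨` is simple and `G^∨ ≅ S^∨ ⟺ G ≅ S`
    classical
    rw [hG.multiplicity_eq, hG.dual.multiplicity_eq]
    exact if_congr exists_bijective_hom_dual_iff rfl rfl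
  · -- `0 → R → G → G/R → 0` dualises to `0 → (G/R)^∨ ≅ R^⊥ → G^∨ → G^∨/R^⊥ ≅ R^∨ → 0`
    show G.dual.multiplicity S.dual = G.multiplicity S
    rw [← R.multiplicity_add S, ← R.annihilator.multiplicity_add S.dual,
      ← multiplicity_eq_of_bijective R.quotientDualHom R.quotientDualHom_bijective S.dual,
      multiplicity_eq_of_bijective R.dualQuotientHom R.dualQuotientHom_bijective S.dual, add_comm]
    exact congrArg₂ (· + ·) hR hQ

/-- **`[H^∨ : S] = [H : S^∨]`** (`S ≅ S^∨∨`). [cite: Beachy1999RingsModules, §2.5, Thm. 2.5.2] [cite: Fujiki1980, (1.6.2) a)] -/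
theorem multiplicity_dual' [FiniteDimensional ℚ V] [FiniteDimensional ℚ U] (H : MixedHodgeStructure V) (S : MixedHodgeStructure U) :
    H.dual.multiplicity S = H.multiplicity S.dual := by
  rw [multiplicity_congr H.dual (Hom.bidual S) (Hom.bidual_bijective S), multiplicity_dual]

/-- `[H^∨∨ : S] = [H : S]`. [cite: Fujiki1980, (1.6.2) a)] [cite: Beachy1999RingsModules, §2.5, Thm. 2.5.2] -/
theorem multiplicity_dual_dual [FiniteDimensional ℚ V] (H : MixedHodgeStructure V) (S : MixedHodgeStructure U) :
    H.dual.dual.multiplicity S = H.multiplicity S :=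
  (multiplicity_eq_of_bijective (Hom.bidual H) (Hom.bidual_bijective H) S).symm

/-- A self-dual `S ≅ S^∨` has the same multiplicity in `H` and in `H^∨`. [cite: Beachy1999RingsModules, §2.5, Thm. 2.5.2] [cite: Fujiki1980, (1.6.2)] -/
theorem multiplicity_dual_of_selfDual [FiniteDimensional ℚ V] [FiniteDimensional ℚ U] (H : MixedHodgeStructure V)
    {S : MixedHodgeStructure U} (e : Hom S S.dual) (he : Function.Bijective e.toLinearMap) :
    H.dual.multiplicity S = H.multiplicity S := by
  rw [multiplicity_dual', ← multiplicity_congr H e he]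

/-! ### §4 The factors of the dual composition series -/

/-- The lower term of the `i`-th factor of the dual series `s^∨` (the orthogonals of the terms of `s`, in reverse
order) is `(s_{j+1})^⊥` with `j = n - 1 - i`. [cite: Fujiki1980, (1.6.2) b)] [cite: Beachy1999RingsModules, §2.5, Def. 2.5.1] -/
theorem CompositionSeries.dual_castSucc_eq [FiniteDimensional ℚ V] (s : H.CompositionSeries) (i : Fin s.dual.length) :
    s.dual i.castSucc = (ofElt (s (Fin.rev (Fin.cast s.dual_length i)).succ)).annihilator.toElt := by
  have hi : (i : ℕ) < s.length := i.2
  have e : Fin.rev i.castSucc = ((Fin.rev (Fin.cast s.dual_length i)).succ : Fin (s.length + 1)) :=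
    Fin.ext (by simp only [Fin.val_rev, Fin.val_castSucc, Fin.val_succ, Fin.val_cast, CompositionSeries.dual_length]; omega)
  exact congrArg (fun k : Fin (s.length + 1) => (ofElt (s k)).annihilator.toElt) e

/-- The upper term of the `i`-th factor of `s^∨` is `(s_j)^⊥` with `j = n - 1 - i`. [cite: Fujiki1980, (1.6.2) b)]
[cite: Beachy1999RingsModules, §2.5, Def. 2.5.1] -/
theorem CompositionSeries.dual_succ_eq [FiniteDimensional ℚ V] (s : H.CompositionSeries) (i : Fin s.dual.length) :
    s.dual i.succ = (ofElt (s (Fin.rev (Fin.cast s.dual_length i)).castSucc)).annihilator.toElt := by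
  have hi : (i : ℕ) < s.length := i.2
  have e : Fin.rev i.succ = ((Fin.rev (Fin.cast s.dual_length i)).castSucc : Fin (s.length + 1)) :=
    Fin.ext (by simp only [Fin.val_rev, Fin.val_castSucc, Fin.val_succ, Fin.val_cast, CompositionSeries.dual_length]; omega)
  exact congrArg (fun k : Fin (s.length + 1) => (ofElt (s k)).annihilator.toElt) e

/-- **The `i`-th factor of `s^∨` is the dual of the `(n-1-i)`-th factor of `s`**: it is `≅ S^∨` iff that factor of `s`
is `≅ S`. [cite: Fujiki1980, (1.6.2) b)] [cite: Beachy1999RingsModules, §2.5, Def. 2.5.1] -/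
theorem CompositionSeries.subquotientIsoTo_dual_iff [FiniteDimensional ℚ V] [FiniteDimensional ℚ U] (s : H.CompositionSeries)
    (i : Fin s.dual.length) :
    SubquotientIsoTo (ofElt (s.dual i.castSucc)) (ofElt (s.dual i.succ)) S.dual ↔
      SubquotientIsoTo (ofElt (s (Fin.rev (Fin.cast s.dual_length i)).castSucc))
        (ofElt (s (Fin.rev (Fin.cast s.dual_length i)).succ)) S := by
  rw [s.dual_castSucc_eq, s.dual_succ_eq, ofElt_toElt, ofElt_toElt]
  exact subquotientIsoTo_annihilator_dual_iff_of_le (s.covBy_succ _).le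

/-- **`s^∨` has as many factors `≅ S^∨` as `s` has factors `≅ S`** (a second proof of `multiplicity_dual` on series).
[cite: Beachy1999RingsModules, §2.5, Def. 2.5.1 and Thm. 2.5.2] [cite: Fujiki1980, (1.6.2) b)] -/
theorem CompositionSeries.count_dual [FiniteDimensional ℚ V] [FiniteDimensional ℚ U] (s : H.CompositionSeries)
    (S : MixedHodgeStructure U) : s.dual.count S.dual = s.count S := by
  classical
  set g : Fin s.length → ℕ := fun j => if SubquotientIsoTo (ofElt (s j.castSucc)) (ofElt (s j.succ)) S then 1 else 0 with hg
  rw [count_eq, count_eq]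
  calc (∑ i : Fin s.dual.length, if SubquotientIsoTo (ofElt (s.dual i.castSucc)) (ofElt (s.dual i.succ)) S.dual then 1 else 0)
      = ∑ i : Fin s.dual.length, g (Fin.rev (Fin.cast s.dual_length i)) :=
        Finset.sum_congr rfl fun i _ => if_congr (s.subquotientIsoTo_dual_iff i) rfl rfl
    _ = ∑ j : Fin s.length, g (Fin.rev j) := by
        rw [← Equiv.sum_comp (finCongr s.dual_length) (fun j => g (Fin.rev j))]
        simp only [finCongr_apply]
    _ = ∑ j : Fin s.length, g j := Equiv.sum_comp Fin.revPerm g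

end MixedHodgeStructure

end Literature.AlgebraicGeometry.Motives
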